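import Mathlib
import HarnessLib
import HarnessLib.Audit
import Summits.ResolutionOfSingularities.Statement
import Summits.ResolutionOfSingularities.ResolutionOfSingularities.Statement
import Literature.AlgebraicGeometry.Resolution.AlterationsPurelyInseparable
import Summits.ResolutionOfSingularities.ResolutionOfSingularities.Theorems.PAlterationPalterationThesisPialtOfPerfect
import Summits.ResolutionOfSingularities.ResolutionOfSingularities.Theorems.PAlterationPalterationThesisIffSummit
import HarnessLib.Audit.Status.Attr

/-!
Route: WildQuotient

DORMANT since 2026-08-29T19:42:00Z (census g0: costume|duplicate of route-ResolutionOfSingularities-WildQuotients; reader census-reader-63-g0) — unstaffed, not closed; items shared with open routes are served there. `ledger route dormant <id> --off` reactivates.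

# Route WildQuotient — Abramovich–de Jong transfer — resolve wild quotients of regular Galois
alterations

TRANSFER of the characteristic-0 proof of weak resolution by Abramovich–de Jong (AbramovichJong1996;
AbramovichOort2000 §8; BerghRydh2019 Thm 6): (i) Galois alteration X' → X with X' regular and G
finite, (ii) X'/G has tame quotient singularities, toroidal after torification, hence resolved,
(iii) X'/G → X is birational. In characteristic p step (i) survives verbatim (DeJong1997 Cor 5.15,
any ground field: 'resolved up to quotient singularities and a purely inseparable extension of
R(X)'), step (iii) degrades to 'purely inseparable' and is repaired by the Frobenius sandwich + the
shared crux Picover (both PROVED glue in tree), and step (ii) BREAKS: wild quotient singularities.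
It suffices to show, for every prime p: X = WildQuotientResolution_p (crux, rank 2: every integral
separated finite-type scheme over a PERFECT field of characteristic p that is Zariski-locally the
invariant ring Spec S^G of a finite group G acting on a regular finitely generated domain S has a
resolution) ∧ Picover_p (crux, rank 3, = stmt-0554 of route pAlteration verbatim: finite radicial
covers of regular varieties are resolvable) ∧ GaloisQuotientAlteration_p (crux, rank 4, de Jong's
THEOREM typed: every variety over a perfect field of characteristic p admits a purely inseparable
alteration by such a locally-S^G scheme). The two remaining steps of the assembly are NOT items but
PROVED lemmas invoked inside the crux-only deciding theorem (rev 2): the composition step (a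
resolution of the source of a purely inseparable alteration of X composes to a REGULAR purely
inseparable alteration of X — Literature
`IsPurelyInseparableAlteration.comp/.exists_dense/.surjective` +
`Scheme.HasResolution.exists_isPurelyInseparableAlteration_and_isRegular`, DeJong1996 2.20,
Temkin2013 §1) and the perfect-field frame (summit ↔ Pialt ∧ Picover, and Pialt descends from the
perfect closure — route pAlteration's Theorems `resolutionOfSingularities_iff_pialt_and_picover` +
`PalterationThesis.PerfectTransfer.stub_pialtOfPerfect`), both imported by the route file; their
constants enter only the PROOF of `closes`, so the dependency cone stays the route's own items +
`Scheme.HasResolution`/`Scheme.IsRegular` (13 project constants, 0 unproved; mock elaboration rc 0,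
closes certified, axioms ⊆ {propext, Classical.choice, Quot.sound}). Realises card
tame-ghost-of-a-wild-action-v2 (the engine for the rank-2 crux: Király–Lütkebohmert's criterion +
residue-weighted equivariant blow-ups) and files the 'sibling thesis' that route pAlteration's
header defers ('DeJong1997 5.15 + resolution of wild quotient singularities Y/G').
Lean: `WildQuotientResolution ∧ GaloisQuotientAlteration ∧ Picover`

## Assembly
`theorem closes (hW : WildQuotientResolution) (hG : GaloisQuotientAlteration) (hP : Picover) :
_root_.ResolutionOfSingularities` (rev 2, crux-only; elaborates sorry-free, certified). Proof:
rewrite the summit as Pialt ∧ Picover (`Theorems.resolutionOfSingularities_iff_pialt_and_picover`,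
PROVED: reduced → integral → normal, Frobenius sandwich fed with Picover) and feed hP (the shared
item stmt-0554 is the same term in both route files); for Pialt over an arbitrary field k of
characteristic p apply `stub_pialtOfPerfect` (PROVED: perfect closure + finite-level descent),
leaving Abramovich–Oort over the PERFECT field K = k^{p^{-∞}}: given X integral separated of finite
type over K, (1) GaloisQuotientAlteration gives ψ : Y → X proper and surjective with Y integral and
Zariski-locally Spec S^G (S regular), finite and universally injective over a dense open of X; (2)
WildQuotientResolution resolves Y (ψ ≫ f is separated, locally of finite type and quasi-compact
because ψ is proper — instances); (3) the resolution π : Y' → Y is a purely inseparable alteration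
with regular source (`Scheme.HasResolution.exists_isPurelyInseparableAlteration_and_isRegular`), so
π ≫ ψ is a REGULAR purely inseparable alteration of X (`IsPurelyInseparableAlteration.comp`,
`.exists_dense`, `.surjective`). Route-file imports (rev 2): Statement +
Literature.AlgebraicGeometry.Resolution.AlterationsPurelyInseparable +
Theorems.PAlterationPalterationThesisPialtOfPerfect +
Theorems.PAlterationPalterationThesisIffSummit.

Rationale: WHY THIS LINE. Of the characteristic-0 proofs, Hironaka/BM/Włodarczyk transfer to route
WeightedInvariant (maximal contact breaks), Zariski's LU to Valuative, Cossart–Piltant dim 3 to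
CyclicCovers, Bogomolov–Pantev (fine moduli of pointed genus-0 curves, then Abhyankar's lemma) to
CleanCovers; the one classical proof not yet transported is Abramovich–de Jong's
(AbramovichJong1996, AbramovichOort2000 Thm 2.8/Cor 2.9/§8, BerghRydh2019 Thm 1/6), whose first step
is a THEOREM in characteristic p (DeJong1997 Thm 5.13/Cor 5.15, stated by Bergh–Rydh over any field)
and whose only failing step is local and group-theoretic: a finite p-group acting on a REGULAR
scheme has a non-toroidal, possibly non-Cohen–Macaulay ring of invariants (Peskin1983,
Lorenzini2014, LorenziniSchroer2019; Yasuda2021 §13: 'a good place to search for counterexamples to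
resolution'; KerzSaito2011 isolate exactly this as hypothesis (RS)_eq). Imported: equivariant
birational geometry of finite group actions and invariant theory of modular representations
(Király–Lütkebohmert's augmentation-ideal criterion KiralyLutkebohmert2013 Thm 2: B regular local,
Z/p acting, I_σ = ((σ−1)B) principal ⇒ B^σ regular; Serre's pseudo-reflection theorem is its tame
shadow), toric geometry of the 'tame ghost' weights (card tame-ghost-of-a-wild-action-v2,
critic-graded new-mechanism: plain equivariant blow-ups run Euclid mod p and cycle, residue-weighted
blow-ups principalise I_σ in one step in every computed case, dims 2–4), and Frobenius arithmetic
for the p.i. residue (in tree: `resolutionOfSingularities ↔ Pialt-over-perfect-fields ∧ Picover`,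
Theorems/PAlterationPalterationThesisPerfectTransfer + Assembly2). What it does that no open route
does: the regular scheme sits on TOP of the singularity (Y = X'/G with X' regular), dual to
CleanCovers/Kedlaya where it sits at the bottom (X finite over P^n); no valuation, no hypersurface
invariant, no field descent crux (imperfect fields are free for Pialt, proved in tree), and the
Abramovich–Oort CONJECTURE that pAlteration must assume (stmt-0555) is replaced by de Jong's theorem
plus the wild-quotient crux.

RANKED CRUXES. #2 WildQuotientResolution (crux) — For every prime p, every perfect field k of
characteristic p and every integral separated k-scheme Y of finite type such that every point of Y
has an open neighbourhood isomorphic to Spec of the fixed subalgebra S^G, where S is a regular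
finitely generated k-domain and G a finite group acting on S by k-algebra automorphisms (i.e. Y =
X'/G Zariski-locally, X' regular), Y has a resolution of singularities. The breaking step (ii) of
the Abramovich–de Jong proof; card tame-ghost-of-a-wild-action-v2 K1–K3 is the intended engine
(equivariant blow-ups of X' until the augmentation ideal is invertible, then
KiralyLutkebohmertCriterion, along a central series of a Sylow p-subgroup; tame part by
BerghRydh2019 Thm 5). [difficulty: open-problem] (why it might fail: It is the summit restricted to
quotients X'/G (every counterexample candidate of Yasuda2021 §13 lives here); wild invariant rings
are non-CM, I_σ is not functorial under blow-up, K–L's plain game cycles for p ≥ 5 and the weighted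
cure is proved only to first order; open from dim 4.) [DeJong1997, AbramovichJong1996,
KiralyLutkebohmert2013, Lorenzini2014, LorenziniSchroer2019, Peskin1983, KerzSaito2011, Yasuda2021,
BerghRydh2019, Literature.Barriers.ResolutionOfSingularities.DimensionFourFrontier]
#3 Picover (crux) — PICover_p (shared verbatim with route pAlteration,
stmt-ResolutionOfSingularities-0554): over any field k of characteristic p, an integral scheme X
finite, universally injective and surjective over a regular integral separated finite-type k-scheme
Y has a resolution. It absorbs the second characteristic-p defect of the transfer (X'/G → X is only
purely inseparable): by the in-tree Frobenius sandwich a regular p.i. alteration of X yields a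
proper birational X_1 → X with X_1 a finite radicial cover of a regular scheme. [difficulty:
open-problem] (why it might fail: Open from dim 4 for every p: generically a tower of
alpha_p-torsors t^p = f over a regular base, Temkin's 'inseparable case where all bad things
happen'; kangaroo points and Hauser–Perlega unbounded residual order live in this class.)
[Temkin2013, CossartPiltant2019,
Literature.Barriers.ResolutionOfSingularities.DimensionFourFrontier,
Literature.Barriers.ResolutionOfSingularities.Hauser2003_kangarooShadeIncrease]
#4 GaloisQuotientAlteration (crux) — For every prime p, every perfect field k of characteristic p
and every integral separated finite-type k-scheme X there are a scheme Y and a purely inseparable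
alteration ψ : Y → X — INLINED since rev 1 (cone repair): ψ proper and surjective, Y integral, ψ
finite and universally injective over a dense open of X; no `IsPurelyInseparableAlteration`, whose
Literature file carries the open AbramovichOortConjecture — such that Y is Zariski-locally Spec S^G
with S a regular finitely generated k-domain and G a finite group of k-algebra automorphisms — de
Jong's 'resolution up to quotient singularities and a purely inseparable extension of R(X)'
(DeJong1997 Cor 5.15 with S = Spec k; BerghRydh2019 Thm 1: a Galois alteration (X', G) with X'
regular, Y := X'/G). Step (i) of the transfer; a THEOREM, filed as a crux only because it is an
unproved hypothesis of `closes`. [difficulty: XL] (why it might fail: Only by mis-typing: the scheme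
quotient X'/G needs X' quasi-projective (dJ96 7.3 / dJ97 5.13: projective X'); de Jong may enlarge
the constant field k' ⊋ k, harmless for perfect k (k'^G = k); Lean discharge = dJ97 §5 on the
in-tree dJ96 library + finite group quotients, XL.) [DeJong1997, BerghRydh2019, AbramovichOort2000,
DeJong1996]
#9 KiralyLutkebohmertCriterion (support) — Király–Lütkebohmert 2013, Thm 2 (a) ⇒ (d): let B be a
regular local ring, p a prime and σ a ring automorphism of B with σ^p = 1; if the augmentation ideal
generated by all σ(b) − b is principal and the fixed ring B^⟨σ⟩ is Noetherian, then B^⟨σ⟩ is a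
regular local ring. The local criterion by which the WildQuotientResolution engine certifies
regularity of a wild quotient after equivariant blow-ups; eleven pages of commutative algebra
(monogenicity B = A[y] from an augmentation generator, freeness, Matsumura Thm 51). [difficulty:
provable-now] [KiralyLutkebohmert2013]

TWO-LAYER PLAN. Foreseen glued split of WildQuotientResolution (k ≤ 3, filed only after a census):
WQ ⇐ TameAndSylow → CyclicStep → WQ, where TameAndSylow: after G-equivariant blow-ups of X' making
every inertia group have a NORMAL Sylow p-subgroup (Abbes–Saito-type (NpS), as in route CleanCovers'
engine), X'/G is étale-locally (X'/P_x)/(G_x/P_x) with G_x/P_x of order prime to p, so WQ follows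
from a CANONICAL (Aut-equivariant) resolution of p-group quotients — itself an iteration of the
cyclic step along a central series — plus tame destackification of the prime-to-p residue
(BerghRydh2019 Thm 5, vendored diagonalizable case
`BerghRydh2019_diagonalizableQuotientResolution`); CyclicStep: for σ of order p on a regular
quasi-projective X' over perfect k there is a σ-equivariant proper birational X'' → X' with X''
regular (or a smooth tame DM stack) on which the augmentation ideal I_σ is invertible — then X''/σ
is regular by KiralyLutkebohmertCriterion and X''/σ → X'/σ resolves (card tame-ghost K1+K2+K3:
monomial phase by plain blow-ups, residue-weighted kill, Loewy-clock termination). A direct proof of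
WQ for LINEAR actions on A^n (WQ_lin, bench of card smooth-models-are-cheap: V_4, p = 5) is the
calibration child.

KILL CRITERIA. WildQuotientResolution and Picover are special cases of the summit: a refutation of
either (an explicit X'/G over a perfect field, X' regular, dim ≥ 4, with no resolution — Yasuda's
suggested hunting ground; or a non-resolvable radicial cover of a regular 4-fold) DECIDES THE SUMMIT
NEGATIVELY — file as a problem refutation with evidence, then close the route.
GaloisQuotientAlteration refuted can only be a misstatement (de Jong's theorem): repair the typing
once (restate), never close. The LINE (not the statement) dies, and the route is closed `exhausted`,
if the tame-ghost engine is shown to cycle in dimension 4 under every residue-weighted strategy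
(card falsifier: hybrid game on V_4, p = 5, and a non-product Lorenzini–Schröer action in dim 3) AND
no other equivariant principalisation of I_σ is in sight; it is closed `superseded --by
route-ResolutionOfSingularities-pAlteration` if Pialt (stmt-0555) is proved by other means.
CossartPiltant2019-type results in dim ≤ 3 do not moot it.

NOT DECOMPOSED YET. The Sylow/central-series reduction inside WQ (needs canonicity of the cyclic
step; Gabber's equivariant ℓ'-alteration KerzSaito2011 Thm 2.2 is the tame bookkeeping); the cyclic
step's three phases (card K1 monomialisation of I_σ, K2 ghost-kill, K3 termination) — layer-2
children once a prover census names the stuck phase; the additive/inseparable twin (card K4) is NOT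
part of this route: it is exactly Picover, already staffed by pAlteration/Valuative
(LuAlphaPTorsor); WQ over imperfect fields is deliberately NOT asked (imperfect fields are free for
Pialt, proved in tree); the Lean discharge of GaloisQuotientAlteration (de Jong 1997 §5 + quotients
of quasi-projective schemes by finite groups) is XL formalisation, not mathematics, and is ranked 4;
the two rev-1 supports PialtOfResolvedAlteration and PerfectPialtPicoverFrame are DROPPED in rev 2
(crux-only deciding theorem, ruling 2026-08-16): they were proved bookkeeping, now invoked inside
`closes` as the in-tree lemmas `IsPurelyInseparableAlteration.comp` (Literature) and
`Theorems.resolutionOfSingularities_iff_pialt_and_picover` + `stub_pialtOfPerfect` (route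
pAlteration), whose modules the route file imports; only the PROOF of `closes` touches them, so the
dependency cone is unchanged (13 project constants, 0 unproved, mock rc 0) — the rev-0 dirt
(AbramovichOortConjecture, DeJong1996*, CossartPiltant2019*, Temkin2013 riding in on the glue's
vocabulary) does not recur because no ITEM mentions Literature alteration vocabulary; CONE HYGIENE
still wanted from librarians: move AbramovichOortConjecture out of Alterations.lean into a leaf file
and decouple ResolutionOfCurves/NormalizationOfVarieties from ArithmeticalThreefolds/Alterations
(cleans pAlteration, Descent and UniformComplexity).

CHEAPEST FALSIFIER. For the LINE: the card's own one-step computation, already run (kit j001394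
T1/T9, j001400): on the smallest cycling corner (Lorenzini–Schröer product action, p = 5, digits
(3,1)) the residue-weighted blow-up with weights (3,1) makes I_σ principal in both stacky charts
while control weights (1,3) do not, and the plain Király–Lütkebohmert game does not terminate to
depth 8/10 for p = 5/7 — so the next cheapest kill is the hybrid game to depth 12 on A^4/V_4 (one
Jordan block, p = 5), the smallest wild cyclic quotient 4-fold not covered by dim ≤ 3: a recurring
bad point that is neither monomial-phase nor killed within two Loewy levels retires the engine (one
kit job). For the TYPING: instantiate WildQuotientResolution with G = 1 (Y regular ⇒ resolved by the
identity, consistent) and with Artin's wild Z/2-quotients of regular surfaces (dim 2, resolved by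
Lipman1978, consistent); instantiate GaloisQuotientAlteration at X regular (Y := X, G := 1, ψ := 𝟙,
consistent). Lookup done this session: DeJong1997 p. 620 Cor 5.15 verbatim ('resolved up to quotient
singularities and a purely inseparable extension of R(X)', any excellent base of dim ≤ 2),
BerghRydh2019 p. 4 Thm 1 (any field).

NUMBERS. dim ≤ 3: WQ and Picover known for every p (CossartPiltant2019, in tree
`hasResolution_of_dim_le_three`); dim 2: wild Z/p quotient surface singularities have star-shaped
graphs with (−2)-chains of length ≡ 0 mod p (Lorenzini2014 Thm 6.8), non-star examples (Ito–Schröer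
2015); Király–Lütkebohmert Conj. 9 (I_G principal ⇔ B^G regular) known for p ≤ 3; the card's
plain-game cycles: Fibonacci corner chains to depth 9–11 for p = 5, 7, termination at depth 3 for p
= 3; explicit crepant resolutions of specific wild quotient 4-folds exist (Fan 2023, A^4/A_4 in char
2, doi:10.3792/pjaa.99.014).

DEFINITION REQUESTS. - (definition, for WildQuotientResolution/GaloisQuotientAlteration)
`HasFiniteQuotientSingularityPresentation k Y` under Literature/AlgebraicGeometry/Resolution: the
inlined local condition (∀ y, ∃ G finite, S regular f.g. k-domain with MulSemiringAction G S,
SMulCommClass G k S, open immersion Spec (FixedPoints.subalgebra k S G) → Y through y), next to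
TameQuotientSingularitiesResolution.lean, so both items and
BerghRydh2019_diagonalizableQuotientResolution share one predicate.
- (definition) augmentation ideal and Loewy flag of a finite-order ring automorphism (card
tame-ghost D1): `augIdeal σ := Ideal.span (Set.range fun b => σ b - b)`, `loewy σ j := Ideal.span
(Set.range ((σ - 1)^j))`.
- (cite fact wanted) DeJong1997 Thm 5.13/Cor 5.15 as a named fact `DeJong1997_galoisAlteration` in a
NEW leaf file Literature/AlgebraicGeometry/Resolution/GaloisAlterations.lean importing only
ResolutionOfSingularities.lean + Mathlib (NOT in Alterations.lean, which carries the open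
AbramovichOortConjecture and would re-dirty this route's cone; currently the theorem is only
mentioned in that conjecture's docstring); KiralyLutkebohmert2013 Thm 2 likewise if the support item
is not proved outright.

Novelty: Searches (2026-08-16): lit search --source crossref "wild quotient singularities resolution" (12:
Lorenzini 2013 Math Z, Peskin1983, Obus–Wewers 2019 JAG, Lorenzini–Schröer 2023 ANT, Ito–Schröer
2015, all dim 2 / arithmetic surfaces); lit search --source crossref "crepant resolution quotient
variety positive characteristic" (8: Fan 2023/2026 explicit A^4/A_4 char 2, Yamamoto 2021
pathological char-3 quotients, Liedtke–Martin–Matsumoto 2025 Astérisque isolated lrq quotient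
singularities); lit search --source crossref "wild McKay correspondence Yasuda" (8: Yasuda
2014/2017/2022/2023, Tanno–Yasuda 2021); lit galaxy search --star all "wild quotient singularities"
(1 irrelevant), "quotient singularities in positive characteristic" (0), "wild quotient
singularities resolution positive characteristic" (0), "Cohomological Hasse principle and resolution
of quotient singularities" (0); lit read arXiv:math/9806100 pp. 8–9, 18, 21–23 (AO2000 Thm 2.8, Cor
2.9, Q 2.13, Ex 5.13–5.19, §7, §8), doi:10.5802/aif.1575 pp. 22–23 (dJ97 5.12–5.16 verbatim),
arXiv:1905.00872 p. 4 (B–R Thm 1, 5, 6), doi:10.2140/ant.2013.7.63 pp. 1–4, 9 (K–L Thm 2, Conj 9),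
NYJM 19-31 Kerz–Saito pp. 1, 10, 14 ((RS)_eq, Gabber Thm 2.2), arXiv:2107.07073 pp. 9, 13, 18
(Yasuda); the 7 route files, the 110 open + 70 closed cards
(wild-quotients-divisorialize-fixed-scheme, wild-quotient-purification/peeling, tame-dejong,
witt-lift-galois-quotient, flat-descent-regular-alteration, dejong-four-equals-three-plus-one,
smooth-m  [refs: 10.5802/aif.1575, 10.2140/ant.2013.7.63, math/9806100, 1905.00872, 2107.07073, doi:10.5802/aif.1575, doi:10.2140/ant.2013.7.63, Peskin1983, DeJong1997, AbramovichTemkinWlodarczyk2024, BerghRydh2019, KiralyLutkebohmert2013, KerzSaito2011]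

Barriers (technique_class: galois-alteration, wild-quotient, equivariant-blowup): - technique_class: galois-alteration, wild-quotient, equivariant-blowup
- Literature.Barriers.ResolutionOfSingularities.DimensionFourFrontier: not evaded as a fact (WQ and
Picover are open exactly from dim 4) but evaded in ARCHITECTURE: no LU ⇒ Res patching, no embedded
resolution one dimension down, no induction on dimension at all — de Jong's induction on dimension
is already spent inside the THEOREM GaloisQuotientAlteration; what remains is dimension-free and
local on a regular scheme with a finite group action.
- Literature.Barriers.ResolutionOfSingularities.Narasimhan1983_noSmoothHypersurfaceThroughTopLocus:
evaded — no hypersurface of maximal contact, no coefficient ideal; centres of the engine are strata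
of σ-stable divisors on the regular cover and the non-invertible locus of I_σ.
- Literature.Barriers.ResolutionOfSingularities.Hauser2003_kangarooShadeIncrease: outside its
technique class for WQ (no residual order on a weak-maximal-contact hypersurface; the engine's data
are F_p-residues and Loewy ideals ((σ−1)^j B)); it APPLIES in full to Picover (z^p = F), which this
route shares and does not claim to advance; the bet is that the Galois (separable-wild) half is the
tractable half and that Picover is staffed independently by pAlteration/Valuative.
- Literature.Barriers.ResolutionOfSingularities.hauserPerlega_mohProofBoundFails: same division —
bites Picover, not the quotient game, whose only computed unbounded quantities (Fibonacci exponents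
of the monomial M) are re

History (route lifecycle, newest last):
- 2026-08-16T15:35:19Z · rev 1: restated GaloisQuotientAlteration (stmt-ResolutionOfSingularities-15727), Assembly (stmt-ResolutionOfSingularities-15731) — cone repair (rrepair, D-0023 guardrail): the rev-0 import cone carried 15 unproved Literature facts (AbramovichOortConjecture via Alterations/NormalizationOfVar (planner-rrepair-ResolutionOfSingularities-Wild-1d6688b8-0)
- 2026-08-16T15:35:19Z · rev 1: dropped RegularPialtSandwich, PialtPerfectToAll — cone repair (rrepair, D-0023 guardrail): the rev-0 import cone carried 15 unproved Literature facts (AbramovichOortConjecture via Alterations/NormalizationOfVar (planner-rrepair-ResolutionOfSingularities-Wild-1d6688b8-0)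
- 2026-08-16T16:42:58Z · rev 2: restated Assembly (stmt-ResolutionOfSingularities-15382) — route-repair (rbadge, glue.non-crux-hypothesis): crux-only deciding theorem. closes now takes ONLY the three cruxes (WildQuotientResolution, GaloisQuotientAlter (planner-rbadge-ResolutionOfSingularities-WildQ-1d6688b8-0)
- 2026-08-16T16:42:58Z · rev 2: dropped PialtOfResolvedAlteration, PerfectPialtPicoverFrame — route-repair (rbadge, glue.non-crux-hypothesis): crux-only deciding theorem. closes now takes ONLY the three cruxes (WildQuotientResolution, GaloisQuotientAlter (planner-rbadge-ResolutionOfSingularities-WildQ-1d6688b8-0)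
- 2026-08-23T12:42:17Z · DORMANT — reconciler: no traction for 6.1 d (last activity item-evidence-added at 2026-08-17T10:17:42Z); parked, not closed — `ledger route dormant route-ResolutionOfSing (operator:999:3686801)
- 2026-08-27T16:50:29Z · REACTIVATED — reconciler: reactivated — activity item-evidence-added at 2026-08-27T14:56:31Z after parking at 2026-08-23T12:42:17Z (operator:999:4000599)
- 2026-08-29T19:42:00Z · DORMANT — census g0: costume|duplicate of route-ResolutionOfSingularities-WildQuotients; reader census-reader-63-g0 (operator:999:1699409)

sub-problem: ResolutionOfSingularities · status: dormant · opened planner-plan-lens-ResolutionOfSingularities-transfer-0 2026-08-16T15:17:21Z · rev 2 · ledger route-ResolutionOfSingularities-WildQuotient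
GENERATED by the gate from the ledger (D-0016/17). Provers cite these decls: `theorem foo : Summit.ResolutionOfSingularities.ResolutionOfSingularities.Theses.WildQuotient.<Decl> := …` in Summits/ResolutionOfSingularities/ResolutionOfSingularities/Theorems/<Name>.lean.
-/

namespace Summit.ResolutionOfSingularities.ResolutionOfSingularities.Theses.WildQuotient

open scoped BigOperators Topology Manifold Classical MeasureTheory ProbabilityTheory Matrix InnerProductSpace ComplexConjugate ContinuousMap
open Filter Set Function TopologicalSpace MeasureTheory

attribute [summit_statement] _root_.ResolutionOfSingularities

/-- item stmt-ResolutionOfSingularities-15726 · crux · rank 2 · open · by planner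
why it might fail: It is the summit restricted to quotients X'/G (every counterexample candidate of Yasuda2021 §13 lives here); wild invariant rings are non-CM, I_σ is not functorial under blow-up, K–L's plain game cycles for p ≥ 5 and the weighted cure is proved only to first order; open from dim 4.
sources: DeJong1997, AbramovichJong1996, KiralyLutkebohmert2013, Lorenzini2014, LorenziniSchroer2019, Peskin1983
[crux] For every prime p, every perfect field k of characteristic p and every integral separated
k-scheme Y of finite type such that every point of Y has an open neighbourhood isomorphic to Spec of
the fixed subalgebra S^G, where S is a regular finitely generated k-domain and G a finite group
acting on S by k-algebra automorphisms (i.e. Y = X'/G Zariski-locally, X' regular), Y has a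
resolution of singularities. The breaking step (ii) of the Abramovich–de Jong proof; card
tame-ghost-of-a-wild-action-v2 K1–K3 is the intended engine (equivariant blow-ups of X' until the
augmentation ideal is invertible, then KiralyLutkebohmertCriterion, along a central series of a
Sylow p-subgroup; tame part by BerghRydh2019 Thm 5). [difficulty: open-problem] -/
@[route_item "route-ResolutionOfSingularities-WildQuotient", crux]
def WildQuotientResolution : Prop :=
  ∀ p : ℕ, p.Prime → ∀ (k : Type) [Field k] [CharP k p] [PerfectField k] (Y : AlgebraicGeometry.Scheme.{0}) (g : Y ⟶ AlgebraicGeometry.Spec (.of k)), AlgebraicGeometry.IsSeparated g → AlgebraicGeometry.LocallyOfFiniteType g → AlgebraicGeometry.QuasiCompact g → AlgebraicGeometry.IsIntegral Y → (∀ y : Y, ∃ (G : Type) (_ : Group G) (_ : Finite G) (S : Type) (_ : CommRing S) (_ : IsDomain S) (_ : Algebra k S) (_ : MulSemiringAction G S) (_ : SMulCommClass G k S), Algebra.FiniteType k S ∧ IsRegularRing S ∧ ∃ φ : AlgebraicGeometry.Spec (.of (FixedPoints.subalgebra k S G)) ⟶ Y, AlgebraicGeometry.IsOpenImmersion φ ∧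 y ∈ Set.range φ.base) → Literature.AlgebraicGeometry.Resolution.Scheme.HasResolution Y

/-- item stmt-ResolutionOfSingularities-0554 · crux · rank 3 · open · by planner
why it might fail: Open from dim 4 for every p: generically a tower of alpha_p-torsors t^p = f over a regular base, Temkin's 'inseparable case where all bad things happen'; kangaroo points and Hauser–Perlega unbounded residual order live in this class.
sources: Temkin2013, CossartPiltant2019, Literature.Barriers.ResolutionOfSingularities.DimensionFourFrontier, Literature.Barriers.ResolutionOfSingularities.Hauser2003_kangarooShadeIncrease
PICover_p: over any field k of char p, if Y is a regular integral separated finite-type k-scheme and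
g : X -> Y is finite, universally injective (radicial) and surjective with X integral, then X has a
resolution. The 'inseparable case' (Temkin2013 Rem 1.3.4(iii)); open in dim >= 4. -/
@[route_item "route-ResolutionOfSingularities-WildQuotient", crux]
def Picover : Prop :=
  ∀ p : ℕ, p.Prime → ∀ (k : Type) [Field k] [CharP k p] (Y X : AlgebraicGeometry.Scheme.{0}) (f : Y ⟶ AlgebraicGeometry.Spec (.of k)) (g : X ⟶ Y), AlgebraicGeometry.IsSeparated f → AlgebraicGeometry.LocallyOfFiniteType f → AlgebraicGeometry.QuasiCompact f → AlgebraicGeometry.IsIntegral Y → Literature.AlgebraicGeometry.Resolution.Scheme.IsRegular Y → AlgebraicGeometry.IsIntegral X → AlgebraicGeometry.IsFinite g → AlgebraicGeometry.UniversallyInjective g → Function.Surjective g.base → Literature.AlgebraicGeometry.Resolution.Scheme.HasResolution X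

-- earlier GaloisQuotientAlteration (stmt-ResolutionOfSingularities-15727, replaced 2026-08-16T15:35:19Z -> stmt-ResolutionOfSingularities-15381): retired by None — ∀ p : ℕ, p.Prime → ∀ (k : Type) [Field k] [CharP k p] [PerfectField k] (X : AlgebraicGeometry.Scheme.{0}) (f : X ⟶ AlgebraicGeometry.Spec (.of k)), AlgebraicGeometry.IsSeparated f → AlgebraicGeometry.LocallyOfFiniteType f → AlgebraicGeome
/-- item stmt-ResolutionOfSingularities-15381 · crux · rank 4 · open · by planner
why it might fail: Only by mis-typing: Zariski-local Spec S^G charts need X' quasi-projective (dJ97 5.13 gives X' projective); de Jong may enlarge the constant field, harmless for perfect k; 'surjective + dense open' = 'dominant + nonempty open' for proper ψ and integral X. Lean discharge XL.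
sources: DeJong1997 (doi:10.5802/aif.1575 Thm 5.13, Cor 5.15 p.620), BerghRydh2019 (arXiv:1905.00872 Thm 1), AbramovichOort2000 (arXiv:math/9806100 Thm 2.8, Cor 2.9), DeJong1996
[crux] For every prime p, every perfect field k of characteristic p and every integral separated
finite-type k-scheme X there are a scheme Y and ψ : Y → X with ψ proper and surjective, Y integral,
ψ finite and universally injective over a dense open of X (a purely inseparable alteration — INLINED
in rev 1 so that the route file does not import Literature…Alterations, which carries the open
AbramovichOortConjecture) such that Y is Zariski-locally Spec S^G with S a regular finitely
generated k-domain and G a finite group of k-algebra automorphisms — de Jong's 'resolution up to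
quotient singularities and a purely inseparable extension of R(X)' (DeJong1997 Thm 5.13 / Cor 5.15
with S = Spec k; BerghRydh2019 Thm 1: a Galois alteration (X', G) with X' regular projective, Y :=
X'/G, charts Spec (Γ(X'_aff))^G on G-stable affine opens). Step (i) of the transfer; a THEOREM,
filed as a crux because it is an unproved hypothesis of `closes` whose typing can fail. [difficulty:
XL] -/
@[route_item "route-ResolutionOfSingularities-WildQuotient", crux]
def GaloisQuotientAlteration : Prop :=
  ∀ p : ℕ, p.Prime → ∀ (k : Type) [Field k] [CharP k p] [PerfectField k] (X : AlgebraicGeometry.Scheme.{0}) (f : X ⟶ AlgebraicGeometry.Spec (.of k)), AlgebraicGeometry.IsSeparated f → AlgebraicGeometry.LocallyOfFiniteType f → AlgebraicGeometry.QuasiCompact f → AlgebraicGeometry.IsIntegral X → ∃ (Y : AlgebraicGeometry.Scheme.{0}) (ψ : Y ⟶ X), (AlgebraicGeometry.IsProper ψ ∧ AlgebraicGeometry.IsIntegral Y ∧ Function.Surjective ψ.base ∧ ∃ U : X.Opens, Dense (U : Set X) ∧ AlgebraicGeometry.IsFinite (AlgebraicGeometry.morphismRestrict ψ U) ∧ AlgebraicGeometry.UniversallyInjective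 (AlgebraicGeometry.morphismRestrict ψ U)) ∧ ∀ y : Y, ∃ (G : Type) (_ : Group G) (_ : Finite G) (S : Type) (_ : CommRing S) (_ : IsDomain S) (_ : Algebra k S) (_ : MulSemiringAction G S) (_ : SMulCommClass G k S), Algebra.FiniteType k S ∧ IsRegularRing S ∧ ∃ φ : AlgebraicGeometry.Spec (.of (FixedPoints.subalgebra k S G)) ⟶ Y, AlgebraicGeometry.IsOpenImmersion φ ∧ y ∈ Set.range φ.base

/-- item stmt-ResolutionOfSingularities-15730 · support · rank 9 · open · by planner
sources: KiralyLutkebohmert2013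
[support] Király–Lütkebohmert 2013, Thm 2 (a) ⇒ (d): let B be a regular local ring, p a prime and σ
a ring automorphism of B with σ^p = 1; if the augmentation ideal generated by all σ(b) − b is
principal and the fixed ring B^⟨σ⟩ is Noetherian, then B^⟨σ⟩ is a regular local ring. The local
criterion by which the WildQuotientResolution engine certifies regularity of a wild quotient after
equivariant blow-ups; eleven pages of commutative algebra (monogenicity B = A[y] from an
augmentation generator, freeness, Matsumura Thm 51). [difficulty: provable-now] -/
@[route_item "route-ResolutionOfSingularities-WildQuotient"]
def KiralyLutkebohmertCriterion : Prop :=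
  ∀ (B : Type) [CommRing B] [IsRegularLocalRing B] (p : ℕ), p.Prime → ∀ σ : B ≃+* B, σ ^ p = 1 → (Ideal.span (Set.range fun b : B => σ b - b)).IsPrincipal → IsNoetherianRing (FixedPoints.subring B (Subgroup.zpowers σ)) → IsRegularLocalRing (FixedPoints.subring B (Subgroup.zpowers σ))

-- earlier Assembly (stmt-ResolutionOfSingularities-15382, replaced 2026-08-16T16:42:58Z -> stmt-ResolutionOfSingularities-15784): retired by None — WildQuotientResolution → GaloisQuotientAlteration → Picover → PialtOfResolvedAlteration → PerfectPialtPicoverFrame → _root_.ResolutionOfSingularities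
-- earlier Assembly (stmt-ResolutionOfSingularities-15731, replaced 2026-08-16T15:35:19Z -> stmt-ResolutionOfSingularities-15382): retired by None — WildQuotientResolution → GaloisQuotientAlteration → Picover → RegularPialtSandwich → PialtPerfectToAll → _root_.ResolutionOfSingularities
/-- item stmt-ResolutionOfSingularities-15784 · assembly · rank 1 · open · by planner
sources: DeJong1997, AbramovichJong1996, Temkin2013
[assembly] WildQuotientResolution → GaloisQuotientAlteration → Picover → ResolutionOfSingularities
(rev 2 chain, crux-only: literally the deciding theorem `closes`, whose proof invokes the PROVED
perfect-field frame `Theorems.resolutionOfSingularities_iff_pialt_and_picover` +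
`stub_pialtOfPerfect` and the Literature composition `IsPurelyInseparableAlteration.comp`). -/
@[route_item "route-ResolutionOfSingularities-WildQuotient"]
def Assembly : Prop :=
  WildQuotientResolution → GaloisQuotientAlteration → Picover → _root_.ResolutionOfSingularities

/-! D-0027 §2.1 — DECIDING THEOREM (planner-authored via `route open/edit --closes-file`; by planner-rbadge-ResolutionOfSingularities-WildQ-1d6688b8-0 2026-08-16T16:42:58Z):
its hypotheses are this route's items and its conclusion the sub-problem Statement (glue_lint), and it elaborates with this file. -/

@[closes "route-ResolutionOfSingularities-WildQuotient"] theorem closes (hW : WildQuotientResolution) (hG : GaloisQuotientAlteration) (hP : Picover) :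
    _root_.ResolutionOfSingularities := by
  -- FRAME (PROVED in tree, route pAlteration's Theorems, imported): the summit ↔ Pialt ∧ Picover
  -- (`Theorems.resolutionOfSingularities_iff_pialt_and_picover`: reduced → integral → normal,
  -- Frobenius sandwich fed with Picover), and Pialt descends from the perfect closure
  -- (`Theorems.PalterationThesis.PerfectTransfer.stub_pialtOfPerfect`). `Picover` is the shared item
  -- stmt-0554, the same term in both route files, so `hP` is accepted definitionally.
  refine Summit.ResolutionOfSingularities.ResolutionOfSingularities.Theorems.resolutionOfSingularities_iff_pialt_and_picover.2
    ⟨?_, hP⟩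
  intro p hp k _ _ X₀ f₀ hs₀ hl₀ hq₀ hi₀
  haveI : Fact p.Prime := ⟨hp⟩
  haveI := hs₀
  haveI := hl₀
  haveI := hq₀
  haveI := hi₀
  refine Summit.ResolutionOfSingularities.ResolutionOfSingularities.Theorems.PalterationThesis.PerfectTransfer.stub_pialtOfPerfect
    p k ?_ X₀ f₀
  -- Abramovich–Oort over the PERFECT field K := k^{p^{-∞}}, from the three cruxes:
  intro X f hs hl hq hi
  -- (i) de Jong (crux GaloisQuotientAlteration): a purely inseparable alteration ψ : Y → X by a
  --     Zariski-locally-S^G scheme Y (S regular, G finite)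
  obtain ⟨Y, ψ, ⟨hψ, hY, hsurj, hU⟩, hloc⟩ := hG p hp (PerfectClosure k p) X f hs hl hq hi
  haveI := hψ
  haveI := hY
  haveI := hi
  -- (ii) the wild quotient Y is resolved (crux WildQuotientResolution; ψ ≫ f is separated,
  --      locally of finite type and quasi-compact because ψ is proper)
  have hres : Literature.AlgebraicGeometry.Resolution.Scheme.HasResolution Y :=
    hW p hp (PerfectClosure k p) Y (CategoryTheory.CategoryStruct.comp ψ f) inferInstance
      inferInstance inferInstance hY hloc
  -- (iii) compose (Literature, PROVED: de Jong 1996, 2.20 / Temkin 2013 §1 (i) ⊂ (iii)): the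
  --       resolution of Y followed by ψ is a REGULAR purely inseparable alteration of X
  haveI : AlgebraicGeometry.Surjective ψ := ⟨hsurj⟩
  have hψ' : Literature.AlgebraicGeometry.Resolution.IsPurelyInseparableAlteration ψ := by
    obtain ⟨U, hUd, hfin, hui⟩ := hU
    exact ⟨hY, hψ, inferInstance, U, hUd.nonempty, hfin, hui⟩
  obtain ⟨Y', π, hπ, hreg⟩ := hres.exists_isPurelyInseparableAlteration_and_isRegular
  have hc := hπ.comp hψ'
  obtain ⟨U', hU', hfin', hui'⟩ := hc.exists_dense
  exact ⟨Y', CategoryTheory.CategoryStruct.comp π ψ, hc.isProper, hc.isIntegral, hreg,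
    hc.surjective.1, U', hU', hfin', hui'⟩

end Summit.ResolutionOfSingularities.ResolutionOfSingularities.Theses.WildQuotient
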